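import Summits.QuantumFields.BalabanUV.Gaps.D1PinnedIndexSymmetry
import Summits.QuantumFields.BalabanUV.Gaps.D1RecordIndexSymmetry
import Summits.QuantumFields.BalabanUV.Beta.D1BFx.WardDiagonalSecondMoment

/-!
# `BalabanUV.Gaps.D1IndexSymmetryDictionary` — cell pub-balaban-gaps, row (D1), seat g1-p1: THE CONSUMERS OF (5.8) AT THE TWO LITERALS — with index symmetry a THEOREM
# (`Gaps/D1PinnedIndexSymmetry`, `Gaps/D1RecordIndexSymmetry`) and moment summability a THEOREM (this file, §1, for EVERY jet-data family), leaf-01's Ward dictionary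
# `D1BFx/WardDiagonalSecondMoment` §3 (the CAP lane's DIAGONAL-MOMENTUM form of (1.22)) needs ONLY the END's Ward binder `hW`, and its §4 AXIS-SWAP LAW (the one-channel
# identity behind the β row's by-value covariance test Q-an2-g55-1) needs ONLY the printed (1.21) `PermCovariant` — for the β-lead's pinned family and for the (III′) literal

HONEST FRAMING (cell rule, page 1 of everything): [folklore] kernel algebra BY NAME — an4's `hdec_TbalOf` ∕ `hdec_TshotOf` ∕ `decay510_flipK` + the β sub-cell's
`PolarizationSign.momentSummable_of_decay510` (moment summability of every one-step ∕ one-shot kernel family over jet data, any order `n`), leaf-01 g36's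
`D1BFx.WardDiagonalSecondMoment.tsum_mul_sq_add_eq_two_mul_secondMoment` ∕ `sqMoment_snd_eq_zero_of_ward` ∕ `apply_eq_apply_neg_comp_swap` (HYPOTHESIS-to-conclusion lemmas about an
abstract kernel), and GEN 14's `indexSymmetric_flipK_TbalOf_JsBalAn1` ∕ `indexSymmetric_flipK_TbalOf_JsB12CombShSym`.  The Ward binder `hW : WardTransversal (flipK (TbalOf … j))` ((5.9), the
END's displayed hypothesis) and the permutation covariance `hC : PermCovariant (flipK (TbalOf … j))` ((1.21)) REMAIN HYPOTHESES — NOT proved for either literal anywhere in the tree;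
NOTHING of Bałaban's asserted beyond print; NO coefficient computed or signed; (D1) NOT discharged; 0∕4 row-D1 binders; NOT `BetaPertH`, NOT continuum, NOT Clay.
HONEST DEPENDENCY (b2b cell, verbatim): «continuum YM on T⁴ ⇐ BetaPertH ∧ nine spine estimates (0/9 proved); BetaPertH ⇐ (D1) ∧ (D4) ∧ CAP+tail; G-an2-4 gates asym, D1 and NE2/3/4.»

WHY (census row 83c of `HOME/g1/RESIDUE.md`).  leaf-01 g36 typed, for an ABSTRACT kernel `P`, the dictionary between the CAP lane's diagonal-momentum estimator and (1.22):
`Σ_z P_{μν}(z)·(z_μ + z_ν)² = 2·secondMoment P μ ν` from {`MomentSummable P 3`, `WardTransversal P`, `IndexSymmetric P`}, and the one-channel axis-swap law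
`P_{μν}(z) = P_{μν}(−(z ∘ swap μ ν))` from {`PermCovariant P`, `IndexSymmetric P`}.  At the two literals of row (D1) two of these inputs are now THEOREMS: `IndexSymmetric` (GEN 14)
and `MomentSummable · n` (§1: exponential decay of every `TbalOf Lc Js j` ∕ `TshotOf Lc Jc m`, an4's `hdec_…`).  So (§2, §3): the dictionary holds at the pinned literal and at the
(III′) literal under `hW` ALONE, and the axis-swap law under `PermCovariant` ALONE — the exact residual hypotheses are displayed, nothing else.
CONTENT (all [folklore]; no `def`, 0 sorry): §1 **`momentSummable_TbalOf`**, **`momentSummable_flipK_TbalOf`**, `momentSummable_TshotOf`, `momentSummable_flipK_TshotOf` (GENERIC: any jet data,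
any `n`); §2 the pinned literal: **`diagMomentum_eq_two_mul_secondMoment_JsBalAn1_of_hW`**, `sqMoment_snd_eq_zero_JsBalAn1_of_hW`, **`axisSwap_JsBalAn1_of_permCovariant`**; §3 the (III′)
literal: **`diagMomentum_eq_two_mul_secondMoment_JsB12CombShSym_of_hW`**, `sqMoment_snd_eq_zero_JsB12CombShSym_of_hW`, **`axisSwap_JsB12CombShSym_of_permCovariant`**.

ABSOLUTE RULE (cell charter, verbatim): «No internally-minted statement may enter as a cited fact. Every hypothesis is either kernel-proved in this
package or a verbatim quotation of a PUBLISHED theorem with page reference. The manuscript(s) under audit are NOT citable for their own disputed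
steps — they are the thing under adjudication; programme-internal (2001/route/tribunal) claims are never citable.»

Provenance: cell pub-balaban-gaps, seat g1-p1 GEN 14 (prover-pub-balaban-gaps-g1-p1-g14-0), 2026-08-25; imports built modules only (`Gaps/D1PinnedIndexSymmetry` p388526 ✓,
`Gaps/D1RecordIndexSymmetry` p388779 ✓, `Beta/D1BFx/WardDiagonalSecondMoment` p388111 ✓); no existing file touched.
-/

noncomputable section

open Literature.MathematicalPhysics.QuantumFieldTheory Balaban1983to89 Balaban1983to89.Beta Filter Topology
open OneStepResolventKernel (JetData)
open OneStepKernelFamily (TbalOf TshotOf flipK hdec_TbalOf hdec_TshotOf decay510_flipK)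
open PolarizationSign (IndexSymmetric WardTransversal MomentSummable momentSummable_of_decay510)
open AffineAveraging (box)
open Summit.QuantumFields.BalabanUV.Beta.SymmetrisedStepJets (SymTables)
open Summit.QuantumFields.BalabanUV.Beta.MixedJetTablesPlug (JsBalAn1)
open Summit.QuantumFields.BalabanUV.Beta.CombChartJointEnd (JsB12CombShSym)
open Summit.QuantumFields.BalabanUV.Beta.D1BFx.WardDiagonalSecondMoment (tsum_mul_sq_add_eq_two_mul_secondMoment sqMoment_snd_eq_zero_of_ward apply_eq_apply_neg_comp_swap)
open Summit.QuantumFields.BalabanUV.Gaps.D1PinnedIndexSymmetry (indexSymmetric_flipK_TbalOf_JsBalAn1)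
open Summit.QuantumFields.BalabanUV.Gaps.D1RecordIndexSymmetry (indexSymmetric_flipK_TbalOf_JsB12CombShSym)

namespace Summit.QuantumFields.BalabanUV.Gaps.D1IndexSymmetryDictionary

variable {Lc : ℕ} [NeZero Lc]

/-! ## §1 Every one-step ∕ one-shot kernel family over jet data has summable polynomial moments of every order (exponential decay, an4's `hdec_…`) -/

/-- [folklore] **MOMENT SUMMABILITY OF THE ONE-STEP FAMILY, EVERY ORDER** (GENERIC: any step jet data `Js`, any level, any `n`): `MomentSummable (TbalOf Lc Js j) n` — the typed (5.10)
consequence `PolarizationSign.momentSummable_of_decay510` fed with an4's `hdec_TbalOf`.  (The END files derive the case `n = 3` inline; here it is a named lemma.) -/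
theorem momentSummable_TbalOf (Js : ℕ → JetData 3 Lc) (j n : ℕ) : MomentSummable (TbalOf Lc Js j) n := by
  obtain ⟨C, δ, hδ, hd⟩ := hdec_TbalOf (Lc := Lc) Js j
  exact momentSummable_of_decay510 hδ hd n

/-- [folklore] The same for the FLIPPED one-step kernels of the printed-variable convention (R21): `MomentSummable (flipK (TbalOf Lc Js j)) n` (`decay510_flipK`). -/
theorem momentSummable_flipK_TbalOf (Js : ℕ → JetData 3 Lc) (j n : ℕ) : MomentSummable (flipK (TbalOf Lc Js j)) n := by
  obtain ⟨C, δ, hδ, hd⟩ := hdec_TbalOf (Lc := Lc) Js j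
  exact momentSummable_of_decay510 hδ (fun μ' ν' => decay510_flipK (hd μ' ν')) n

/-- [folklore] **MOMENT SUMMABILITY OF THE ONE-SHOT FAMILY, EVERY ORDER** (any composite jet data `Jc`, any depth, any `n`): `MomentSummable (TshotOf Lc Jc m) n` (`hdec_TshotOf`). -/
theorem momentSummable_TshotOf (Jc : ∀ m : ℕ, JetData 3 (Lc ^ m)) (m n : ℕ) : MomentSummable (TshotOf Lc Jc m) n := by
  obtain ⟨C, δ, hδ, hd⟩ := hdec_TshotOf (Lc := Lc) Jc m
  exact momentSummable_of_decay510 hδ hd n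

/-- [folklore] The same for the flipped one-shot kernels. -/
theorem momentSummable_flipK_TshotOf (Jc : ∀ m : ℕ, JetData 3 (Lc ^ m)) (m n : ℕ) : MomentSummable (flipK (TshotOf Lc Jc m)) n := by
  obtain ⟨C, δ, hδ, hd⟩ := hdec_TshotOf (Lc := Lc) Jc m
  exact momentSummable_of_decay510 hδ (fun μ' ν' => decay510_flipK (hd μ' ν')) n

/-! ## §2 The β-lead's pinned family: leaf-01's dictionary under `hW` alone; the axis-swap law under (1.21) alone -/

section Pinned

variable {r : Fin (3 + 1) → ℕ}

/-- [folklore] **THE DIAGONAL-MOMENTUM FORM OF (1.22) FOR THE PINNED LITERAL UNDER `hW` ALONE** (any root, colour triple, `cE₂`, `cB`, `Tc`, level; `P := flipK (TbalOf Lc (JsBalAn1 …) j)`):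
if `P` is Ward-transversal (the END's displayed (5.9) binder), then `Σ_z P_{μν}(z)·(z_μ + z_ν)² = 2·secondMoment P μ ν` — leaf-01's `tsum_mul_sq_add_eq_two_mul_secondMoment` with its
`MomentSummable` input from §1 and its `IndexSymmetric` input from `indexSymmetric_flipK_TbalOf_JsBalAn1`. -/
theorem diagMomentum_eq_two_mul_secondMoment_JsBalAn1_of_hW (hLc : 1 ≤ Lc) (hr : r ∈ box (3 + 1) Lc) (cE cVH cΛ cE₂ cB : ℝ) (T : Fin 4 → Fin 4 → Fin 4 → Fin 4 → ℝ)
    (j : ℕ) (hW : WardTransversal (flipK (TbalOf Lc (JsBalAn1 hLc hr cE cVH cΛ cE₂ cB T) j))) (μ ν : Fin 4) :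
    ∑' z, flipK (TbalOf Lc (JsBalAn1 hLc hr cE cVH cΛ cE₂ cB T) j) μ ν z * ((z μ : ℝ) + (z ν : ℝ)) ^ 2 =
      2 * B12Beta.secondMoment (flipK (TbalOf Lc (JsBalAn1 hLc hr cE cVH cΛ cE₂ cB T) j)) μ ν :=
  tsum_mul_sq_add_eq_two_mul_secondMoment (momentSummable_flipK_TbalOf _ j 3) hW (indexSymmetric_flipK_TbalOf_JsBalAn1 hLc hr cE cVH cΛ cE₂ cB T j) μ ν

/-- [folklore] Under `hW` alone the second-index one-axis square of the pinned literal's kernel drops: `Σ_z P_{μν}(z)·z_ν² = 0` (leaf-01's `sqMoment_snd_eq_zero_of_ward`, (5.8) supplied). -/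
theorem sqMoment_snd_eq_zero_JsBalAn1_of_hW (hLc : 1 ≤ Lc) (hr : r ∈ box (3 + 1) Lc) (cE cVH cΛ cE₂ cB : ℝ) (T : Fin 4 → Fin 4 → Fin 4 → Fin 4 → ℝ)
    (j : ℕ) (hW : WardTransversal (flipK (TbalOf Lc (JsBalAn1 hLc hr cE cVH cΛ cE₂ cB T) j))) (μ ν : Fin 4) :
    ∑' z, flipK (TbalOf Lc (JsBalAn1 hLc hr cE cVH cΛ cE₂ cB T) j) μ ν z * (z ν : ℝ) ^ 2 = 0 :=
  sqMoment_snd_eq_zero_of_ward (momentSummable_flipK_TbalOf _ j 3) hW (indexSymmetric_flipK_TbalOf_JsBalAn1 hLc hr cE cVH cΛ cE₂ cB T j) μ ν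

/-- [folklore] **THE AXIS-SWAP LAW FOR THE PINNED LITERAL UNDER (1.21) ALONE**: if `P := flipK (TbalOf Lc (JsBalAn1 …) j)` is permutation-covariant (`B12Beta.PermCovariant`, the printed
(1.21) — NOT a theorem for this literal; the axial tree gauge orders the axes), then `P_{μν}(z) = P_{μν}(−(z ∘ swap μ ν))` — leaf-01's `apply_eq_apply_neg_comp_swap` with (5.8) supplied:
the one-channel identity a by-value covariance screen of the pinned literal would test. -/
theorem axisSwap_JsBalAn1_of_permCovariant (hLc : 1 ≤ Lc) (hr : r ∈ box (3 + 1) Lc) (cE cVH cΛ cE₂ cB : ℝ) (T : Fin 4 → Fin 4 → Fin 4 → Fin 4 → ℝ) (j : ℕ)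
    (hC : B12Beta.PermCovariant (flipK (TbalOf Lc (JsBalAn1 hLc hr cE cVH cΛ cE₂ cB T) j))) (μ ν : Fin 4) (z : Fin 4 → ℤ) :
    flipK (TbalOf Lc (JsBalAn1 hLc hr cE cVH cΛ cE₂ cB T) j) μ ν z =
      flipK (TbalOf Lc (JsBalAn1 hLc hr cE cVH cΛ cE₂ cB T) j) μ ν (-(z ∘ ⇑(Equiv.swap μ ν))) :=
  apply_eq_apply_neg_comp_swap hC (indexSymmetric_flipK_TbalOf_JsBalAn1 hLc hr cE cVH cΛ cE₂ cB T j) μ ν z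

end Pinned

/-! ## §3 The b2b wall's (III′) literal over every table record: the same two statements -/

/-- [folklore] **THE DIAGONAL-MOMENTUM FORM OF (1.22) FOR THE (III′) LITERAL UNDER `hW` ALONE** (every table record `tabs`, `N`, `cΛ`, `cB`, level; `Odd Lc`):
`Σ_z P_{μν}(z)·(z_μ + z_ν)² = 2·secondMoment P μ ν` for `P := flipK (TbalOf Lc (JsB12CombShSym …) j)` — the CAP lane's estimator dictionary at the literal of record needs only the END's
(5.9) binder. -/
theorem diagMomentum_eq_two_mul_secondMoment_JsB12CombShSym_of_hW (hLc : Odd Lc) (N : ℕ) (tabs : SymTables 3 Lc) (cΛ cB : ℝ) (j : ℕ)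
    (hW : WardTransversal (flipK (TbalOf Lc (JsB12CombShSym hLc N tabs cΛ cB) j))) (μ ν : Fin 4) :
    ∑' z, flipK (TbalOf Lc (JsB12CombShSym hLc N tabs cΛ cB) j) μ ν z * ((z μ : ℝ) + (z ν : ℝ)) ^ 2 =
      2 * B12Beta.secondMoment (flipK (TbalOf Lc (JsB12CombShSym hLc N tabs cΛ cB) j)) μ ν :=
  tsum_mul_sq_add_eq_two_mul_secondMoment (momentSummable_flipK_TbalOf _ j 3) hW (indexSymmetric_flipK_TbalOf_JsB12CombShSym hLc N tabs cΛ cB j) μ ν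

/-- [folklore] Under `hW` alone the second-index one-axis square of the (III′) literal's kernel drops: `Σ_z P_{μν}(z)·z_ν² = 0`. -/
theorem sqMoment_snd_eq_zero_JsB12CombShSym_of_hW (hLc : Odd Lc) (N : ℕ) (tabs : SymTables 3 Lc) (cΛ cB : ℝ) (j : ℕ)
    (hW : WardTransversal (flipK (TbalOf Lc (JsB12CombShSym hLc N tabs cΛ cB) j))) (μ ν : Fin 4) :
    ∑' z, flipK (TbalOf Lc (JsB12CombShSym hLc N tabs cΛ cB) j) μ ν z * (z ν : ℝ) ^ 2 = 0 :=
  sqMoment_snd_eq_zero_of_ward (momentSummable_flipK_TbalOf _ j 3) hW (indexSymmetric_flipK_TbalOf_JsB12CombShSym hLc N tabs cΛ cB j) μ ν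

/-- [folklore] **THE AXIS-SWAP LAW FOR THE (III′) LITERAL UNDER (1.21) ALONE** (every table record): `PermCovariant P → P_{μν}(z) = P_{μν}(−(z ∘ swap μ ν))` for
`P := flipK (TbalOf Lc (JsB12CombShSym …) j)` — the one-channel identity behind the β row's by-value covariance question Q-an2-g55-1, with its (5.8) input now a theorem; `PermCovariant` of
the literal is OPEN (neither proved nor refuted in the tree). -/
theorem axisSwap_JsB12CombShSym_of_permCovariant (hLc : Odd Lc) (N : ℕ) (tabs : SymTables 3 Lc) (cΛ cB : ℝ) (j : ℕ)
    (hC : B12Beta.PermCovariant (flipK (TbalOf Lc (JsB12CombShSym hLc N tabs cΛ cB) j))) (μ ν : Fin 4) (z : Fin 4 → ℤ) :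
    flipK (TbalOf Lc (JsB12CombShSym hLc N tabs cΛ cB) j) μ ν z = flipK (TbalOf Lc (JsB12CombShSym hLc N tabs cΛ cB) j) μ ν (-(z ∘ ⇑(Equiv.swap μ ν))) :=
  apply_eq_apply_neg_comp_swap hC (indexSymmetric_flipK_TbalOf_JsB12CombShSym hLc N tabs cΛ cB j) μ ν z

end Summit.QuantumFields.BalabanUV.Gaps.D1IndexSymmetryDictionary

end
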